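import Mathlib
import Literature.Computability.AlgebraicComplexity.PrattTrapezoidVal
import Literature.Computability.AlgebraicComplexity.PrattTrapezoidValBounds
import Literature.Computability.AlgebraicComplexity.LocalStrongUSP
import Summits.MatrixMultiplication.MatrixMultiplication.Theorems.SoloBlindPrattValCyclic
import Summits.MatrixMultiplication.MatrixMultiplication.Theorems.SoloBlindPrattValCube

/-!
# `Val(𝔽₂ᵏ) > 2ᵏ` for every `k ≥ 8`

Solo-blind line Q12 (Pratt's `Val`, arXiv:2309.03878, Def. 3.2 / Prop. 3.4; tree `prattVal`,
`card_le_prattVal : |G| ≤ Val(G)`), twelfth file.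

An earlier note of this line asked whether `Val(𝔽₂ᵏ) = 2ᵏ` for every `k` (a SAT census gives equality
for `k ≤ 4`), on the grounds that no coordinate (USP-type) configuration with `𝔽₂`-valued
coordinates can exceed the order (the USP capacity `3/2^{2/3}` is `< 2`).  The grounds are too
narrow: the coordinate groups of CKSU's construction may be ANY finite abelian groups (tree:
`soloVal_le_prattVal_pi_of_isLocalStrongUSP`), in particular `𝔽₂³` and `𝔽₂²`, whose punctured
sizes `7` and `3` are large fractions of `8` and `4`.  The width-3 local strong USP `{123, 231}` in
`𝔽₂³ × 𝔽₂³ × 𝔽₂²` gives `Val ≥ 2 · 7 · 7 · 3 = 294 > 256 = 2⁸`, and in `(𝔽₂³)³` it gives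
`Val ≥ 2 · 7³ = 686 > 512 = 2⁹` (an instance of the landed `soloVal_card_cube_lt_prattVal`, `|K| ≥ 5`).
By super-multiplicativity (`prattVal_mul_le_prattVal_prod`, Pratt Prop. 3.5) and `Val ≥ |·|` on the
complementary factor, `Val(𝔽₂ᵏ) > 2ᵏ` for EVERY `k ≥ 8`.  So the answer to the question is NO; with
the SAT census the least `k` with `Val(𝔽₂ᵏ) > 2ᵏ` lies in `{5, 6, 7, 8}`.

All groups are written in coordinates (`Fin k → ZMod 2`); the passage between `(𝔽₂³)³`,
`𝔽₂³ × 𝔽₂³ × 𝔽₂²` and `𝔽₂⁹`, `𝔽₂⁸` is a linear equivalence of `𝔽₂`-vector spaces of equal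
dimension (`LinearEquiv.ofFinrankEq`) transported through `prattVal_congr`.

No bearing on `ω`: elementary abelian 2-groups are excluded from the STPP route to `ω = 2` by the
slice-rank barrier; the statements concern Pratt's functional itself (when is the trivial bound
`Val(G) ≥ |G|` strict?).
-/

set_option linter.dupNamespace false

namespace Summit.MatrixMultiplication.MatrixMultiplication.Theorems

open Finset Literature.Computability.AlgebraicComplexity

/-- **`Val((𝔽₂³)³) ≥ 2 · 7³ = 686`.** -/
theorem soloVal_prattVal_F8_cube : 686 ≤ prattVal (Fin 3 → Fin 3 → ZMod 2) := by
  have h := soloVal_cube_le_prattVal (Fin 3 → ZMod 2)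
  rw [Fintype.card_fun, ZMod.card, Fintype.card_fin] at h
  norm_num at h
  exact h

/-- **An elementary abelian 2-group of order `512` whose `Val` exceeds its order.** -/
theorem soloVal_card_lt_prattVal_F8_cube :
    Fintype.card (Fin 3 → Fin 3 → ZMod 2) < prattVal (Fin 3 → Fin 3 → ZMod 2) :=
  soloVal_card_cube_lt_prattVal (Fin 3 → ZMod 2)
    (by rw [Fintype.card_fun, ZMod.card, Fintype.card_fin]; norm_num)

/-- **`Val(𝔽₂⁹) ≥ 686 > 512`** (coordinate model). -/
theorem soloVal_prattVal_F2_pow9 : 686 ≤ prattVal (Fin 9 → ZMod 2) := by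
  have e : (Fin 3 → Fin 3 → ZMod 2) ≃ₗ[ZMod 2] (Fin 9 → ZMod 2) :=
    LinearEquiv.ofFinrankEq _ _ (by
      simp [Module.finrank_pi_fintype, Module.finrank_fintype_fun_eq_card])
  rw [← prattVal_congr e.toAddEquiv]
  exact soloVal_prattVal_F8_cube

/-- `|𝔽₂⁹| = 512 < Val(𝔽₂⁹)`. -/
theorem soloVal_card_lt_prattVal_F2_pow9 :
    Fintype.card (Fin 9 → ZMod 2) < prattVal (Fin 9 → ZMod 2) := by
  rw [Fintype.card_fun, ZMod.card, Fintype.card_fin]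
  exact lt_of_lt_of_le (by norm_num) soloVal_prattVal_F2_pow9

/-- **Mixed coordinates `𝔽₂³ × 𝔽₂³ × 𝔽₂²`: `Val ≥ 2 · 7 · 7 · 3 = 294`.** -/
theorem soloVal_prattVal_F2_mixed332 :
    294 ≤ prattVal ((j : Fin 3) → Fin (![3, 3, 2] j) → ZMod 2) := by
  have h := soloVal_le_prattVal_pi_of_isLocalStrongUSP
    (K := fun j : Fin 3 => Fin (![3, 3, 2] j) → ZMod 2) soloVal_isLocalStrongUSP_axesPair
  have h147 : ∏ j : Fin 3, (Fintype.card (Fin (![3, 3, 2] j) → ZMod 2) - 1) = 147 := by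
    simp only [Fintype.card_fun, ZMod.card, Fintype.card_fin]
    decide
  rw [h147] at h
  omega

/-- **`Val(𝔽₂⁸) ≥ 294 > 256`** (coordinate model). -/
theorem soloVal_prattVal_F2_pow8 : 294 ≤ prattVal (Fin 8 → ZMod 2) := by
  have e : ((j : Fin 3) → Fin (![3, 3, 2] j) → ZMod 2) ≃ₗ[ZMod 2] (Fin 8 → ZMod 2) :=
    LinearEquiv.ofFinrankEq _ _ (by
      simp [Module.finrank_pi_fintype, Module.finrank_fintype_fun_eq_card, Fin.sum_univ_three])
  rw [← prattVal_congr e.toAddEquiv]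
  exact soloVal_prattVal_F2_mixed332

/-- `|𝔽₂⁸| = 256 < Val(𝔽₂⁸)`. -/
theorem soloVal_card_lt_prattVal_F2_pow8 :
    Fintype.card (Fin 8 → ZMod 2) < prattVal (Fin 8 → ZMod 2) := by
  rw [Fintype.card_fun, ZMod.card, Fintype.card_fin]
  exact lt_of_lt_of_le (by norm_num) soloVal_prattVal_F2_pow8

/-- **`Val(𝔽₂ᵏ) > 2ᵏ` for every `k ≥ 8`** (`𝔽₂ᵏ ≅ 𝔽₂⁸ × 𝔽₂^{k−8}`, super-multiplicativity, and
`Val ≥ |·|` on the second factor: `Val ≥ 294 · 2^{k−8} > 2ᵏ`). -/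
theorem soloVal_card_lt_prattVal_F2_pow {k : ℕ} (hk : 8 ≤ k) :
    Fintype.card (Fin k → ZMod 2) < prattVal (Fin k → ZMod 2) := by
  obtain ⟨j, rfl⟩ : ∃ j, k = 8 + j := ⟨k - 8, by omega⟩
  have e : (Fin (8 + j) → ZMod 2) ≃ₗ[ZMod 2] (Fin 8 → ZMod 2) × (Fin j → ZMod 2) :=
    (LinearEquiv.funCongrLeft (ZMod 2) (ZMod 2) finSumFinEquiv).trans
      (LinearEquiv.sumArrowLequivProdArrow (Fin 8) (Fin j) (ZMod 2) (ZMod 2))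
  rw [prattVal_congr e.toAddEquiv, Fintype.card_fun, ZMod.card, Fintype.card_fin, pow_add]
  have hj : 2 ^ j ≤ prattVal (Fin j → ZMod 2) := by
    have h := card_le_prattVal (G := Fin j → ZMod 2)
    rwa [Fintype.card_fun, ZMod.card, Fintype.card_fin] at h
  have hpos : 0 < 2 ^ j := by positivity
  calc 2 ^ 8 * 2 ^ j < 294 * 2 ^ j := mul_lt_mul_of_pos_right (by norm_num) hpos
    _ ≤ prattVal (Fin 8 → ZMod 2) * prattVal (Fin j → ZMod 2) :=
        Nat.mul_le_mul soloVal_prattVal_F2_pow8 hj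
    _ ≤ prattVal ((Fin 8 → ZMod 2) × (Fin j → ZMod 2)) := prattVal_mul_le_prattVal_prod

/-- The explicit lower bound behind the previous theorem: `294 · 2^{k−8} ≤ Val(𝔽₂ᵏ)` (`k ≥ 8`). -/
theorem soloVal_prattVal_F2_pow_ge {k : ℕ} (hk : 8 ≤ k) :
    294 * 2 ^ (k - 8) ≤ prattVal (Fin k → ZMod 2) := by
  obtain ⟨j, rfl⟩ : ∃ j, k = 8 + j := ⟨k - 8, by omega⟩
  have e : (Fin (8 + j) → ZMod 2) ≃ₗ[ZMod 2] (Fin 8 → ZMod 2) × (Fin j → ZMod 2) :=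
    (LinearEquiv.funCongrLeft (ZMod 2) (ZMod 2) finSumFinEquiv).trans
      (LinearEquiv.sumArrowLequivProdArrow (Fin 8) (Fin j) (ZMod 2) (ZMod 2))
  rw [prattVal_congr e.toAddEquiv, show 8 + j - 8 = j by omega]
  have hj : 2 ^ j ≤ prattVal (Fin j → ZMod 2) := by
    have h := card_le_prattVal (G := Fin j → ZMod 2)
    rwa [Fintype.card_fun, ZMod.card, Fintype.card_fin] at h
  exact (Nat.mul_le_mul soloVal_prattVal_F2_pow8 hj).trans prattVal_mul_le_prattVal_prod

end Summit.MatrixMultiplication.MatrixMultiplication.Theorems
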